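import Literature.Combinatorics.Optimization.HoffmanCirculationProofs
import Literature.LinearAlgebra.Matrix.ScalingCutConditions
import HarnessLib

/-!
# Nonnegative matrices with prescribed pattern and margins: SUFFICIENCY of the cut conditions
# (Menon 1968 ∕ Brualdi 1968; Idel Theorem 4.1 (iv) ⇒ (ii), Theorem 4.2 (v) ⇒ (iii)) — hence Menon's theorem in
# full: `A ≥ 0` is diagonally scalable to margins `(r, c)` iff `Σ_I r ≥ Σ_J c` whenever `A_{IᶜJ} = 0`, with equality
# iff `A_{IJᶜ} = 0`

Layer `Literature/LinearAlgebra/Matrix`, namespace `Literature.LinearAlgebra.Matrix.PatternMarginsCutConditions`.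
Written for lane `lit-hodgefound` (prover seat `lit-hodgefound-p31`, gen 42, row g42-#3); completes
✔ `ScalingCutConditions.lean` (g41-#13: the NECESSITY halves, «sufficiency (Menon 1969 ∕ Brualdi 1968: a
flow-feasibility theorem) is not [formalised]») using the tree's ✔ HOFFMAN CIRCULATION THEOREM
(`Literature.Combinatorics.Optimization.Hoffman1960_circulationTheorem_holds`, Bondy–Murty Thm 20.9) on the
transportation network of `A` (Idel §4, after [sch90b]: source → rows (capacity `r_i`) → columns along the support of
`A` → sink (capacity `c_j`); here closed up into a circulation network through one hub vertex), and
✔ `MatrixScalingPattern.lean` (g41-#7: Idel Theorem 3.1, pattern + margins ⇔ scaling). Everything is PROVED; no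
definition, no named fact.

## Source (held text, verbatim)

M. Idel, *A review of matrix scaling and Sinkhorn's normal form for matrices and positive maps*, arXiv:1609.06349
[cite: Idel2016] (held text `paper:arxiv-1609.06349`):
* §4 Theorem 4.1, p0013: «Let `A ∈ ℝ^{n×m}` be a nonnegative matrix and `r ∈ ℝ^n_+, c ∈ ℝ^m_+`. Then the following are
  equivalent: • There exist positive diagonal matrices `D₁, D₂` such that `D₁AD₂` has row sums `r` and column sums
  `c`. • There exists a matrix `B` with row sums `r` and column sums `c` with the same pattern as `A`
  ([men68, bru68]). • … • For every `I ⊂ {1,…,m}, J ⊂ {1,…,n}` such that `A_{IᶜJ} = 0` we have that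
  `Σ_{i∈I} r_i ≥ Σ_{j∈J} c_j` and equality holds if and only if `A_{IJᶜ} = 0` ([men69]). • …»
* §4 Theorem 4.2, p0013: «… the following are equivalent: • … • There exists a matrix `B ≺ A` with row sums `r` and
  column sums `c` ([sch80]). • … • For every `I ⊂ {1,…,m}, J ⊂ {1,…,n}` such that `A_{IᶜJ} = 0` we have that
  `Σ_{i∈I} r_i ≥ Σ_{j∈J} c_j`»
* §4, p0014 (the network): «consider the bipartite graph with the bipartition given by the vertices `M` and `N` and
  the edges defined via `E = {(i,j) : A_ij > 0}`, directed from `i ∈ M` to `j ∈ N`. Now we define a source `S₁` that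
  connects to each vertex in `M`, where the edges have capacity `r_i` … and we define a sink `S₂` that is connected
  from every vertex in `N`, where the edges have capacities `c_j` … the matrix is approximately scalable if and only
  if the maximum flow of this network is equal to `Σ_i r_i`. The flows along the edges `E` then define a matrix with
  the wanted pattern. The matrix is exactly scalable if and only if the maximum flow of this network is equal to
  `Σ_i r_i` and every edge contains flow.»

## What is proved

* §1 The circulation network of `A`: vertices `Option (m ⊕ n)` (hub `none`, rows, columns), arcs `m ⊕ (m × n) ⊕ n`
  (hub → row `i` with bounds `[r_i, r_i]`; row `i` → column `j` with bounds `[lo_ij, up_ij]`; column `j` → hub with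
  bounds `[c_j, c_j]`): vertex balances (`outSum_row`, `inSum_row`, `outSum_col`, `inSum_col`), the two cut
  inequalities that imply Hoffman's condition (`hoffman_condition_of_cuts`), and the read-out of a matrix with
  `lo ≤ B ≤ up` and margins `(r, c)` from a feasible circulation (`exists_matrix_of_cuts`).
* §2 **Gale–Hoffman supply–demand ∕ Idel Theorem 4.2 (v) ⇒ (iii)** (`exists_subpattern_margins_of_cut`): if
  `r, c ≥ 0`, `Σ r = Σ c` and `Σ_J c ≤ Σ_I r` whenever `A_{IᶜJ} = 0`, there is `B ≥ 0`, `B ≺ A` (zero where `A` is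
  zero) with row sums `r` and column sums `c`; and the equivalence `exists_subpattern_margins_iff`.
* §3 **Menon–Brualdi ∕ Idel Theorem 4.1 (iv) ⇒ (ii)** (`exists_pattern_margins_of_menon`): if moreover equality holds
  exactly when `A_{IJᶜ} = 0`, `B` can be taken with the SAME pattern as `A` (lower bounds `ε > 0` on the support arcs,
  `ε` below every positive cut slack); **(ii) ⇔ (iv)** `exists_pattern_margins_iff_menon` (with ✔ g41-#13) and
  **(i) ⇔ (iv)** `exists_scaling_iff_menon` for `A ≥ 0` (with ✔ Idel Theorem 3.1).

DECLARED deviations. (i) The flow network of p0014 is used in circulation form (one hub vertex carrying the arcs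
`S₁ → i` and `j → S₂` with lower = upper bounds), and feasibility comes from Hoffman's circulation theorem rather
than max-flow–min-cut; (ii) `r`, `c` are only assumed nonnegative (print: `ℝ_+`), `A` arbitrary real in §2–§3 (only
its zero pattern enters) and `A ≥ 0` where scalings are concerned; (iii) index types live in `Type` (universe of
the tree's Hoffman theorem).
-/

open Finset Matrix
open Literature.Combinatorics.Optimization

namespace Literature.LinearAlgebra.Matrix.PatternMarginsCutConditions

variable {m n : Type} [Fintype m] [Fintype n] [DecidableEq m] [DecidableEq n]

/-! ### §1 The circulation network of a matrix pattern -/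

section Network

variable (tail head : m ⊕ (m × n) ⊕ n → Option (m ⊕ n))

/-- Out-flow of a row vertex: the arcs `i → j`. [cite: Idel2016, §4 (the transportation network), p0014] -/
private theorem outSum_row (ht₁ : ∀ i, tail (Sum.inl i) = none)
    (ht₂ : ∀ p : m × n, tail (Sum.inr (Sum.inl p)) = some (Sum.inl p.1))
    (hh₂ : ∀ p : m × n, head (Sum.inr (Sum.inl p)) = some (Sum.inr p.2))
    (ht₃ : ∀ j, tail (Sum.inr (Sum.inr j)) = some (Sum.inr j)) (f : m ⊕ (m × n) ⊕ n → ℝ) (i : m) :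
    outSum tail head f {some (Sum.inl i)} = ∑ j, f (Sum.inr (Sum.inl (i, j))) := by
  rw [outSum_eq_sum_ite, Fintype.sum_sum_type, Fintype.sum_sum_type, Fintype.sum_prod_type]
  simp [ht₁, ht₂, hh₂, ht₃]

/-- In-flow of a row vertex: the arc `hub → i`. [cite: Idel2016, §4 (the transportation network), p0014] -/
private theorem inSum_row (ht₁ : ∀ i, tail (Sum.inl i) = none) (hh₁ : ∀ i, head (Sum.inl i) = some (Sum.inl i))
    (hh₂ : ∀ p : m × n, head (Sum.inr (Sum.inl p)) = some (Sum.inr p.2))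
    (hh₃ : ∀ j, head (Sum.inr (Sum.inr j)) = none) (f : m ⊕ (m × n) ⊕ n → ℝ) (i : m) :
    inSum tail head f {some (Sum.inl i)} = f (Sum.inl i) := by
  rw [inSum_eq_sum_ite, Fintype.sum_sum_type, Fintype.sum_sum_type, Fintype.sum_prod_type]
  simp [ht₁, hh₁, hh₂, hh₃, Finset.sum_ite_eq']

/-- Out-flow of a column vertex: the arc `j → hub`. [cite: Idel2016, §4 (the transportation network), p0014] -/
private theorem outSum_col (ht₁ : ∀ i, tail (Sum.inl i) = none)
    (ht₂ : ∀ p : m × n, tail (Sum.inr (Sum.inl p)) = some (Sum.inl p.1))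
    (ht₃ : ∀ j, tail (Sum.inr (Sum.inr j)) = some (Sum.inr j)) (hh₃ : ∀ j, head (Sum.inr (Sum.inr j)) = none)
    (f : m ⊕ (m × n) ⊕ n → ℝ) (j : n) :
    outSum tail head f {some (Sum.inr j)} = f (Sum.inr (Sum.inr j)) := by
  rw [outSum_eq_sum_ite, Fintype.sum_sum_type, Fintype.sum_sum_type, Fintype.sum_prod_type]
  simp [ht₁, ht₂, ht₃, hh₃, Finset.sum_ite_eq']

/-- In-flow of a column vertex: the arcs `i → j`. [cite: Idel2016, §4 (the transportation network), p0014] -/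
private theorem inSum_col (hh₁ : ∀ i, head (Sum.inl i) = some (Sum.inl i))
    (ht₂ : ∀ p : m × n, tail (Sum.inr (Sum.inl p)) = some (Sum.inl p.1))
    (hh₂ : ∀ p : m × n, head (Sum.inr (Sum.inl p)) = some (Sum.inr p.2))
    (hh₃ : ∀ j, head (Sum.inr (Sum.inr j)) = none) (f : m ⊕ (m × n) ⊕ n → ℝ) (j : n) :
    inSum tail head f {some (Sum.inr j)} = ∑ i, f (Sum.inr (Sum.inl (i, j))) := by
  rw [inSum_eq_sum_ite, Fintype.sum_sum_type, Fintype.sum_sum_type, Fintype.sum_prod_type]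
  simp [hh₁, ht₂, hh₂, hh₃, Finset.sum_ite_eq']

/-- **Hoffman's cut condition for the network, from two families of matrix inequalities.** With lower bounds
`(r, lo, c)` and upper bounds `(r, up, c)` on the arcs (hub → row, row → column, column → hub), the condition
`b⁻(X) ≤ c⁺(X)` for every vertex set `X` (rows `I₀`, columns `J₀`, hub in or out) reads:
(hub ∉ X) `Σ_{I₀} r + Σ_{I₀ᶜ×J₀} lo ≤ Σ_{I₀×J₀ᶜ} up + Σ_{J₀} c`; (hub ∈ X) `Σ_{I₀ᶜ×J₀} lo + Σ_{J₀ᶜ} c ≤ Σ_{I₀ᶜ} r + Σ_{I₀×J₀ᶜ} up`.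
[cite: Idel2016, §4 (the transportation network), p0014] -/
private theorem hoffman_condition_of_cuts (ht₁ : ∀ i, tail (Sum.inl i) = none)
    (hh₁ : ∀ i, head (Sum.inl i) = some (Sum.inl i))
    (ht₂ : ∀ p : m × n, tail (Sum.inr (Sum.inl p)) = some (Sum.inl p.1))
    (hh₂ : ∀ p : m × n, head (Sum.inr (Sum.inl p)) = some (Sum.inr p.2))
    (ht₃ : ∀ j, tail (Sum.inr (Sum.inr j)) = some (Sum.inr j)) (hh₃ : ∀ j, head (Sum.inr (Sum.inr j)) = none)
    (r : m → ℝ) (c : n → ℝ) (lo up : m × n → ℝ)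
    (h1 : ∀ (I₀ : Finset m) (J₀ : Finset n),
      ∑ i ∈ I₀, r i + ∑ p ∈ I₀ᶜ ×ˢ J₀, lo p ≤ ∑ p ∈ I₀ ×ˢ J₀ᶜ, up p + ∑ j ∈ J₀, c j)
    (h2 : ∀ (I₀ : Finset m) (J₀ : Finset n),
      ∑ p ∈ I₀ᶜ ×ˢ J₀, lo p + ∑ j ∈ J₀ᶜ, c j ≤ ∑ i ∈ I₀ᶜ, r i + ∑ p ∈ I₀ ×ˢ J₀ᶜ, up p)
    (X : Finset (Option (m ⊕ n))) :
    inSum tail head (Sum.elim r (Sum.elim lo c)) X ≤ outSum tail head (Sum.elim r (Sum.elim up c)) X := by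
  set I₀ : Finset m := univ.filter fun i ↦ some (Sum.inl i) ∈ X with hI₀
  set J₀ : Finset n := univ.filter fun j ↦ some (Sum.inr j) ∈ X with hJ₀
  have hI : ∀ i, i ∈ I₀ ↔ some (Sum.inl i) ∈ X := fun i ↦ by simp [hI₀]
  have hJ : ∀ j, j ∈ J₀ ↔ some (Sum.inr j) ∈ X := fun j ↦ by simp [hJ₀]
  -- the pair sums as filtered sums over all pairs
  have hlo : ∑ p ∈ I₀ᶜ ×ˢ J₀, lo p =
      ∑ p : m × n, if some (Sum.inr p.2) ∈ X ∧ some (Sum.inl p.1) ∉ X then lo p else 0 := by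
    rw [← Finset.sum_filter]
    refine Finset.sum_congr ?_ fun _ _ ↦ rfl
    ext p
    simp [hI, hJ, and_comm]
  have hup : ∑ p ∈ I₀ ×ˢ J₀ᶜ, up p =
      ∑ p : m × n, if some (Sum.inl p.1) ∈ X ∧ some (Sum.inr p.2) ∉ X then up p else 0 := by
    rw [← Finset.sum_filter]
    refine Finset.sum_congr ?_ fun _ _ ↦ rfl
    ext p
    simp [hI, hJ]
  have hrI : ∀ g : m → ℝ, ∑ i ∈ I₀, g i = ∑ i, if some (Sum.inl i) ∈ X then g i else 0 := fun g ↦ by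
    rw [← Finset.sum_filter]
  have hrIc : ∀ g : m → ℝ, ∑ i ∈ I₀ᶜ, g i = ∑ i, if some (Sum.inl i) ∉ X then g i else 0 := fun g ↦ by
    rw [← Finset.sum_filter]
    refine Finset.sum_congr ?_ fun _ _ ↦ rfl
    ext i; simp [hI]
  have hcJ : ∀ g : n → ℝ, ∑ j ∈ J₀, g j = ∑ j, if some (Sum.inr j) ∈ X then g j else 0 := fun g ↦ by
    rw [← Finset.sum_filter]
  have hcJc : ∀ g : n → ℝ, ∑ j ∈ J₀ᶜ, g j = ∑ j, if some (Sum.inr j) ∉ X then g j else 0 := fun g ↦ by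
    rw [← Finset.sum_filter]
    refine Finset.sum_congr ?_ fun _ _ ↦ rfl
    ext j; simp [hJ]
  rw [inSum_eq_sum_ite, outSum_eq_sum_ite, Fintype.sum_sum_type, Fintype.sum_sum_type, Fintype.sum_sum_type,
    Fintype.sum_sum_type]
  simp only [Sum.elim_inl, Sum.elim_inr, ht₁, hh₁, ht₂, hh₂, ht₃, hh₃]
  by_cases hX : none ∈ X
  · have h := h2 I₀ J₀
    rw [hlo, hup, hrIc, hcJc] at h
    simpa [hX] using h
  · have h := h1 I₀ J₀
    rw [hlo, hup, hrI, hcJ] at h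
    simpa [hX] using h

end Network

/-- **From cut inequalities to a matrix** (the network argument of Idel §4 run through Hoffman's circulation
theorem): given `lo ≤ up` on the pairs and the two families of cut inequalities of `hoffman_condition_of_cuts`,
there is a matrix `B` with `lo ≤ B ≤ up`, row sums `r` and column sums `c` («The flows along the edges `E` then
define a matrix with the wanted pattern»). [cite: Idel2016, §4 (the transportation network), p0014] -/
theorem exists_matrix_of_cuts (r : m → ℝ) (c : n → ℝ) (lo up : m × n → ℝ) (hle : ∀ p, lo p ≤ up p)
    (h1 : ∀ (I₀ : Finset m) (J₀ : Finset n),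
      ∑ i ∈ I₀, r i + ∑ p ∈ I₀ᶜ ×ˢ J₀, lo p ≤ ∑ p ∈ I₀ ×ˢ J₀ᶜ, up p + ∑ j ∈ J₀, c j)
    (h2 : ∀ (I₀ : Finset m) (J₀ : Finset n),
      ∑ p ∈ I₀ᶜ ×ˢ J₀, lo p + ∑ j ∈ J₀ᶜ, c j ≤ ∑ i ∈ I₀ᶜ, r i + ∑ p ∈ I₀ ×ˢ J₀ᶜ, up p) :
    ∃ B : Matrix m n ℝ, (∀ i j, lo (i, j) ≤ B i j ∧ B i j ≤ up (i, j)) ∧ (∀ i, ∑ j, B i j = r i) ∧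
      ∀ j, ∑ i, B i j = c j := by
  -- the network
  let tail : m ⊕ (m × n) ⊕ n → Option (m ⊕ n) :=
    Sum.elim (fun _ ↦ none) (Sum.elim (fun p ↦ some (Sum.inl p.1)) fun j ↦ some (Sum.inr j))
  let head : m ⊕ (m × n) ⊕ n → Option (m ⊕ n) :=
    Sum.elim (fun i ↦ some (Sum.inl i)) (Sum.elim (fun p ↦ some (Sum.inr p.2)) fun _ ↦ none)
  have ht₁ : ∀ i, tail (Sum.inl i) = none := fun _ ↦ rfl
  have hh₁ : ∀ i, head (Sum.inl i) = some (Sum.inl i) := fun _ ↦ rfl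
  have ht₂ : ∀ p : m × n, tail (Sum.inr (Sum.inl p)) = some (Sum.inl p.1) := fun _ ↦ rfl
  have hh₂ : ∀ p : m × n, head (Sum.inr (Sum.inl p)) = some (Sum.inr p.2) := fun _ ↦ rfl
  have ht₃ : ∀ j, tail (Sum.inr (Sum.inr j)) = some (Sum.inr j) := fun _ ↦ rfl
  have hh₃ : ∀ j, head (Sum.inr (Sum.inr j)) = none := fun _ ↦ rfl
  have hbc : ∀ a, Sum.elim r (Sum.elim lo c) a ≤ Sum.elim r (Sum.elim up c) a := by
    rintro (i | p | j)
    · exact le_rfl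
    · exact hle p
    · exact le_rfl
  obtain ⟨f, hcons, hbounds⟩ :=
    (Hoffman1960_circulationTheorem_holds.1 (Option (m ⊕ n)) (m ⊕ (m × n) ⊕ n) tail head
      (Sum.elim r (Sum.elim lo c)) (Sum.elim r (Sum.elim up c)) hbc).2
      (hoffman_condition_of_cuts tail head ht₁ hh₁ ht₂ hh₂ ht₃ hh₃ r c lo up h1 h2)
  refine ⟨of fun i j ↦ f (Sum.inr (Sum.inl (i, j))), fun i j ↦ ?_, fun i ↦ ?_, fun j ↦ ?_⟩
  · exact ⟨(hbounds (Sum.inr (Sum.inl (i, j)))).1, (hbounds (Sum.inr (Sum.inl (i, j)))).2⟩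
  · -- balance at the row vertex: `Σ_j f(i,j) = f(hub → i) = r_i`
    have h := hcons (some (Sum.inl i))
    rw [outSum_row tail head ht₁ ht₂ hh₂ ht₃, inSum_row tail head ht₁ hh₁ hh₂ hh₃] at h
    have hri : f (Sum.inl i) = r i :=
      le_antisymm (hbounds (Sum.inl i)).2 (hbounds (Sum.inl i)).1
    simpa [hri] using h
  · have h := hcons (some (Sum.inr j))
    rw [outSum_col tail head ht₁ ht₂ ht₃ hh₃, inSum_col tail head hh₁ ht₂ hh₂ hh₃] at h
    have hcj : f (Sum.inr (Sum.inr j)) = c j :=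
      le_antisymm (hbounds (Sum.inr (Sum.inr j))).2 (hbounds (Sum.inr (Sum.inr j))).1
    simpa [hcj] using h.symm

/-! ### §2 Idel Theorem 4.2 (v) ⇒ (iii): a SUB-pattern matrix with prescribed margins (Gale–Hoffman) -/

/-- **Idel Theorem 4.2, (v) ⇒ (iii) (Gale–Hoffman supply–demand theorem).** Let `r, c ≥ 0` with `Σ r = Σ c`, and
suppose `Σ_{j∈J} c_j ≤ Σ_{i∈I} r_i` whenever `A_{IᶜJ} = 0`. Then there is `B ≥ 0` with `B ≺ A` (`b_ij = 0` wherever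
`a_ij = 0`), row sums `r` and column sums `c` («There exists a matrix `B ≺ A` with row sums `r` and column sums
`c`»). Proof: Hoffman's condition for the network with bounds `[0, M·1_{supp A}]` on the arcs `i → j`
(`M = Σ r`). [cite: Idel2016, §4 Theorem 4.2 ((v) ⇒ (iii)), p0013–p0014] -/
theorem exists_subpattern_margins_of_cut (A : Matrix m n ℝ) {r : m → ℝ} {c : n → ℝ} (hr : ∀ i, 0 ≤ r i)
    (hc : ∀ j, 0 ≤ c j) (hsum : ∑ i, r i = ∑ j, c j)
    (hcut : ∀ (I : Finset m) (J : Finset n), (∀ i ∉ I, ∀ j ∈ J, A i j = 0) → ∑ j ∈ J, c j ≤ ∑ i ∈ I, r i) :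
    ∃ B : Matrix m n ℝ, (∀ i j, 0 ≤ B i j) ∧ (∀ i j, A i j = 0 → B i j = 0) ∧ (∀ i, ∑ j, B i j = r i) ∧
      ∀ j, ∑ i, B i j = c j := by
  obtain ⟨M, hM⟩ : ∃ M : ℝ, M = ∑ i, r i := ⟨_, rfl⟩
  have hM0 : 0 ≤ M := hM ▸ sum_nonneg fun i _ ↦ hr i
  set up : m × n → ℝ := fun p ↦ if A p.1 p.2 = 0 then 0 else M with hup
  have hup0 : ∀ p, 0 ≤ up p := fun p ↦ by simp only [hup]; split_ifs <;> simp [hM0]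
  -- partial sums are bounded by the totals
  have hrI : ∀ I : Finset m, ∑ i ∈ I, r i ≤ M := fun I ↦
    hM ▸ sum_le_sum_of_subset_of_nonneg (subset_univ I) fun i _ _ ↦ hr i
  have hcJ : ∀ J : Finset n, ∑ j ∈ J, c j ≤ M := fun J ↦ by
    rw [hM, hsum]; exact sum_le_sum_of_subset_of_nonneg (subset_univ J) fun j _ _ ↦ hc j
  have hrc : ∀ I : Finset m, ∑ i ∈ Iᶜ, r i = M - ∑ i ∈ I, r i := fun I ↦ by
    rw [hM, ← sum_add_sum_compl I]; ring
  have hcc : ∀ J : Finset n, ∑ j ∈ Jᶜ, c j = M - ∑ j ∈ J, c j := fun J ↦ by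
    rw [hM, hsum, ← sum_add_sum_compl J]; ring
  -- a support arc across the cut gives `M`
  have hbig : ∀ (I₀ : Finset m) (J₀ : Finset n), (∃ i ∈ I₀, ∃ j ∉ J₀, A i j ≠ 0) →
      M ≤ ∑ p ∈ I₀ ×ˢ J₀ᶜ, up p := fun I₀ J₀ ⟨i, hi, j, hj, hij⟩ ↦ by
    have hmem : (i, j) ∈ I₀ ×ˢ J₀ᶜ := mem_product.2 ⟨hi, mem_compl.2 hj⟩
    calc M = up (i, j) := by simp [hup, hij]
      _ ≤ ∑ p ∈ I₀ ×ˢ J₀ᶜ, up p := single_le_sum (fun p _ ↦ hup0 p) hmem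
  have h1 : ∀ (I₀ : Finset m) (J₀ : Finset n),
      ∑ i ∈ I₀, r i + ∑ p ∈ I₀ᶜ ×ˢ J₀, (fun _ : m × n ↦ (0 : ℝ)) p ≤ ∑ p ∈ I₀ ×ˢ J₀ᶜ, up p + ∑ j ∈ J₀, c j := by
    intro I₀ J₀
    simp only [sum_const_zero, add_zero]
    by_cases hex : ∃ i ∈ I₀, ∃ j ∉ J₀, A i j ≠ 0
    · calc ∑ i ∈ I₀, r i ≤ M := hrI I₀
        _ ≤ ∑ p ∈ I₀ ×ˢ J₀ᶜ, up p := hbig I₀ J₀ hex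
        _ ≤ ∑ p ∈ I₀ ×ˢ J₀ᶜ, up p + ∑ j ∈ J₀, c j := le_add_of_nonneg_right (sum_nonneg fun j _ ↦ hc j)
    · push Not at hex
      have h := hcut I₀ᶜ J₀ᶜ fun i hi j hj ↦ hex i (by simpa using hi) j (by simpa using hj)
      rw [hrc, hcc] at h
      calc ∑ i ∈ I₀, r i ≤ ∑ j ∈ J₀, c j := by linarith
        _ ≤ ∑ p ∈ I₀ ×ˢ J₀ᶜ, up p + ∑ j ∈ J₀, c j := le_add_of_nonneg_left (sum_nonneg fun p _ ↦ hup0 p)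
  have h2 : ∀ (I₀ : Finset m) (J₀ : Finset n),
      ∑ p ∈ I₀ᶜ ×ˢ J₀, (fun _ : m × n ↦ (0 : ℝ)) p + ∑ j ∈ J₀ᶜ, c j ≤ ∑ i ∈ I₀ᶜ, r i + ∑ p ∈ I₀ ×ˢ J₀ᶜ, up p := by
    intro I₀ J₀
    simp only [sum_const_zero, zero_add]
    by_cases hex : ∃ i ∈ I₀, ∃ j ∉ J₀, A i j ≠ 0
    · calc ∑ j ∈ J₀ᶜ, c j ≤ M := hcJ J₀ᶜ
        _ ≤ ∑ p ∈ I₀ ×ˢ J₀ᶜ, up p := hbig I₀ J₀ hex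
        _ ≤ ∑ i ∈ I₀ᶜ, r i + ∑ p ∈ I₀ ×ˢ J₀ᶜ, up p := le_add_of_nonneg_left (sum_nonneg fun i _ ↦ hr i)
    · push Not at hex
      have h := hcut I₀ᶜ J₀ᶜ fun i hi j hj ↦ hex i (by simpa using hi) j (by simpa using hj)
      exact h.trans (le_add_of_nonneg_right (sum_nonneg fun p _ ↦ hup0 p))
  obtain ⟨B, hB, hBr, hBc⟩ := exists_matrix_of_cuts r c (fun _ ↦ 0) up (fun p ↦ hup0 p) h1 h2
  refine ⟨B, fun i j ↦ (hB i j).1, fun i j hij ↦ ?_, hBr, hBc⟩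
  have h := (hB i j).2
  simp only [hup, hij, if_true] at h
  exact le_antisymm h (hB i j).1

omit [DecidableEq m] [DecidableEq n] in
/-- The necessity of the cut inequalities for a sub-pattern matrix: if `B ≥ 0`, `B ≺ A` has margins `(r, c)` and
`A_{IᶜJ} = 0`, then the columns in `J` are supported on the rows in `I`, so `Σ_J c ≤ Σ_I r`; and `Σ r = Σ c`.
[cite: Idel2016, §4 Theorem 4.2 ((iii) ⇒ (v)), p0013] -/
theorem cut_of_subpattern_margins {A B : Matrix m n ℝ} {r : m → ℝ} {c : n → ℝ} (hB : ∀ i j, 0 ≤ B i j)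
    (hsub : ∀ i j, A i j = 0 → B i j = 0) (hBr : ∀ i, ∑ j, B i j = r i) (hBc : ∀ j, ∑ i, B i j = c j)
    {I : Finset m} {J : Finset n} (hzero : ∀ i ∉ I, ∀ j ∈ J, A i j = 0) : ∑ j ∈ J, c j ≤ ∑ i ∈ I, r i := by
  calc ∑ j ∈ J, c j = ∑ j ∈ J, ∑ i, B i j := sum_congr rfl fun j _ ↦ (hBc j).symm
    _ = ∑ j ∈ J, ∑ i ∈ I, B i j := by
        refine sum_congr rfl fun j hj ↦ ?_
        rw [← sum_subset (subset_univ I) fun i _ hi ↦ hsub i j (hzero i hi j hj)]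
    _ = ∑ i ∈ I, ∑ j ∈ J, B i j := sum_comm
    _ ≤ ∑ i ∈ I, ∑ j, B i j := sum_le_sum fun i _ ↦
        sum_le_sum_of_subset_of_nonneg (subset_univ J) fun j _ _ ↦ hB i j
    _ = ∑ i ∈ I, r i := sum_congr rfl fun i _ ↦ hBr i

/-- **Idel Theorem 4.2, (iii) ⇔ (v)** (for `r, c ≥ 0`): a nonnegative `B ≺ A` with row sums `r` and column sums `c`
exists iff `Σ r = Σ c` and `Σ_{j∈J} c_j ≤ Σ_{i∈I} r_i` whenever `A_{IᶜJ} = 0`.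
[cite: Idel2016, §4 Theorem 4.2 ((iii) ⇔ (v)), p0013] -/
theorem exists_subpattern_margins_iff (A : Matrix m n ℝ) {r : m → ℝ} {c : n → ℝ} (hr : ∀ i, 0 ≤ r i)
    (hc : ∀ j, 0 ≤ c j) :
    (∃ B : Matrix m n ℝ, (∀ i j, 0 ≤ B i j) ∧ (∀ i j, A i j = 0 → B i j = 0) ∧ (∀ i, ∑ j, B i j = r i) ∧
      ∀ j, ∑ i, B i j = c j) ↔
    ∑ i, r i = ∑ j, c j ∧
      ∀ (I : Finset m) (J : Finset n), (∀ i ∉ I, ∀ j ∈ J, A i j = 0) → ∑ j ∈ J, c j ≤ ∑ i ∈ I, r i := by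
  constructor
  · rintro ⟨B, hB, hsub, hBr, hBc⟩
    exact ⟨(ScalingCutConditions.sum_col_eq_sum_row hBr hBc).symm,
      fun I J hzero ↦ cut_of_subpattern_margins hB hsub hBr hBc hzero⟩
  · rintro ⟨hsum, hcut⟩
    exact exists_subpattern_margins_of_cut A hr hc hsum hcut

/-! ### §3 Idel Theorem 4.1 (iv) ⇒ (ii): the SAME pattern (Menon–Brualdi) -/

omit [DecidableEq m] [DecidableEq n] in
/-- A uniform `ε > 0` below every positive cut slack (finitely many cuts): `ε N ≤ 1` and `ε N ≤ δ(I₀, J₀)` whenever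
`δ(I₀, J₀) > 0`. [folklore] -/
private theorem exists_eps (δ : Finset m → Finset n → ℝ) (N : ℝ) (hN : 0 ≤ N) :
    ∃ ε : ℝ, 0 < ε ∧ ε * N ≤ 1 ∧ ∀ I₀ J₀, 0 < δ I₀ J₀ → ε * N ≤ δ I₀ J₀ := by
  classical
  set S : Finset ℝ := (((univ : Finset (Finset m)) ×ˢ (univ : Finset (Finset n))).image
    fun q ↦ δ q.1 q.2).filter (fun x ↦ 0 < x) with hS
  have hmemS : ∀ I₀ J₀, 0 < δ I₀ J₀ → δ I₀ J₀ ∈ S := fun I₀ J₀ h ↦ by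
    simp only [hS, mem_filter, mem_image, mem_product, mem_univ, true_and]
    exact ⟨⟨(I₀, J₀), rfl⟩, h⟩
  set δ₀ : ℝ := if h : S.Nonempty then S.min' h else 1 with hδ₀
  have hδ₀pos : 0 < δ₀ := by
    simp only [hδ₀]
    split_ifs with h
    · have := min'_mem S h
      simp only [hS, mem_filter] at this
      exact this.2
    · exact one_pos
  have hδ₀le : ∀ I₀ J₀, 0 < δ I₀ J₀ → δ₀ ≤ δ I₀ J₀ := fun I₀ J₀ h ↦ by
    have hne : S.Nonempty := ⟨_, hmemS I₀ J₀ h⟩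
    simp only [hδ₀, dif_pos hne]
    exact min'_le S _ (hmemS I₀ J₀ h)
  refine ⟨min 1 δ₀ / (N + 1), by positivity, ?_, fun I₀ J₀ h ↦ ?_⟩
  · calc min 1 δ₀ / (N + 1) * N ≤ min 1 δ₀ := by
          rw [div_mul_eq_mul_div, div_le_iff₀ (by positivity)]
          nlinarith [le_min zero_le_one hδ₀pos.le, min_le_left (1 : ℝ) δ₀]
      _ ≤ 1 := min_le_left _ _
  · calc min 1 δ₀ / (N + 1) * N ≤ min 1 δ₀ := by
          rw [div_mul_eq_mul_div, div_le_iff₀ (by positivity)]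
          nlinarith [le_min zero_le_one hδ₀pos.le, min_le_left (1 : ℝ) δ₀]
      _ ≤ δ₀ := min_le_right _ _
      _ ≤ δ I₀ J₀ := hδ₀le I₀ J₀ h

/-- **Idel Theorem 4.1, (iv) ⇒ (ii) (Menon 1968 ∕ Brualdi 1968: sufficiency of the cut conditions for a matrix with the
SAME pattern).** Let `r, c ≥ 0`, and suppose that for all `I`, `J` with `A_{IᶜJ} = 0`: `Σ_{j∈J} c_j ≤ Σ_{i∈I} r_i`,
with equality iff `A_{IJᶜ} = 0`. Then there is `B ≥ 0` with the same pattern as `A` (`a_ij = 0 ↔ b_ij = 0`), row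
sums `r` and column sums `c` («There exists a matrix `B` with row sums `r` and column sums `c` with the same pattern
as `A`»). Proof: the network with bounds `[ε, M]` on the support arcs («exactly scalable if and only if … every edge
contains flow»), `ε > 0` below every positive cut slack; the equality clause makes the slack positive exactly when
support arcs enter the cut. [cite: Idel2016, §4 Theorem 4.1 ((iv) ⇒ (ii)), p0013–p0014] -/
theorem exists_pattern_margins_of_menon (A : Matrix m n ℝ) {r : m → ℝ} {c : n → ℝ} (hr : ∀ i, 0 ≤ r i)
    (hc : ∀ j, 0 ≤ c j)
    (hcut : ∀ (I : Finset m) (J : Finset n), (∀ i ∉ I, ∀ j ∈ J, A i j = 0) →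
      ∑ j ∈ J, c j ≤ ∑ i ∈ I, r i ∧ (∑ j ∈ J, c j = ∑ i ∈ I, r i ↔ ∀ i ∈ I, ∀ j ∉ J, A i j = 0)) :
    ∃ B : Matrix m n ℝ, (∀ i j, 0 ≤ B i j) ∧ (∀ i j, A i j = 0 ↔ B i j = 0) ∧ (∀ i, ∑ j, B i j = r i) ∧
      ∀ j, ∑ i, B i j = c j := by
  -- total balance `Σ r = Σ c` (the cut `I = univ`, `J = univ`, whose equality clause holds vacuously)
  have hsum : ∑ i, r i = ∑ j, c j := by
    have h := hcut univ univ fun i hi ↦ absurd (mem_univ i) hi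
    exact (h.2.2 fun i _ j hj ↦ absurd (mem_univ j) hj).symm
  obtain ⟨M, hM⟩ : ∃ M : ℝ, M = ∑ i, r i + 1 := ⟨_, rfl⟩
  have hM0 : 0 ≤ M := by have := sum_nonneg fun i (_ : i ∈ univ) ↦ hr i; linarith
  -- the slack of a cut and a uniform `ε`
  set δ : Finset m → Finset n → ℝ := fun I₀ J₀ ↦ ∑ j ∈ J₀, c j - ∑ i ∈ I₀, r i with hδ
  obtain ⟨ε, hε, hεN, hεδ⟩ := exists_eps δ (Fintype.card (m × n)) (Nat.cast_nonneg _)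
  set lo : m × n → ℝ := fun p ↦ if A p.1 p.2 = 0 then 0 else ε with hlo
  set up : m × n → ℝ := fun p ↦ if A p.1 p.2 = 0 then 0 else M with hup
  have hlo0 : ∀ p, 0 ≤ lo p := fun p ↦ by simp only [hlo]; split_ifs <;> simp [hε.le]
  have hloε : ∀ p, lo p ≤ ε := fun p ↦ by simp only [hlo]; split_ifs <;> simp [hε.le]
  have hup0 : ∀ p, 0 ≤ up p := fun p ↦ by simp only [hup]; split_ifs <;> simp [hM0]
  have hle : ∀ p, lo p ≤ up p := fun p ↦ by
    -- a pair exists, so `#pairs ≥ 1` and `ε ≤ ε · #pairs ≤ 1 ≤ M`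
    have hc1 : (1 : ℝ) ≤ Fintype.card (m × n) := by
      have : 0 < Fintype.card (m × n) := Fintype.card_pos_iff.2 ⟨p⟩
      exact_mod_cast this
    have hεM : ε ≤ M := by
      have := sum_nonneg fun i (_ : i ∈ univ) ↦ hr i
      nlinarith
    simp only [hlo, hup]; split_ifs
    · exact le_rfl
    · exact hεM
  -- partial sums vs totals
  have hrI : ∀ I : Finset m, ∑ i ∈ I, r i ≤ ∑ i, r i := fun I ↦
    sum_le_sum_of_subset_of_nonneg (subset_univ I) fun i _ _ ↦ hr i
  have hcJ : ∀ J : Finset n, ∑ j ∈ J, c j ≤ ∑ i, r i := fun J ↦ by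
    rw [hsum]; exact sum_le_sum_of_subset_of_nonneg (subset_univ J) fun j _ _ ↦ hc j
  have hrc : ∀ I : Finset m, ∑ i ∈ Iᶜ, r i = ∑ i, r i - ∑ i ∈ I, r i := fun I ↦ by
    rw [← sum_add_sum_compl I]; ring
  have hcc : ∀ J : Finset n, ∑ j ∈ Jᶜ, c j = ∑ i, r i - ∑ j ∈ J, c j := fun J ↦ by
    rw [hsum, ← sum_add_sum_compl J]; ring
  -- the `lo`-mass entering a cut is at most `ε · #pairs`
  have hloN : ∀ (I₀ : Finset m) (J₀ : Finset n), ∑ p ∈ I₀ᶜ ×ˢ J₀, lo p ≤ ε * Fintype.card (m × n) :=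
    fun I₀ J₀ ↦ by
    calc ∑ p ∈ I₀ᶜ ×ˢ J₀, lo p ≤ ∑ p ∈ I₀ᶜ ×ˢ J₀, ε := sum_le_sum fun p _ ↦ hloε p
      _ ≤ ∑ _p : m × n, ε := sum_le_sum_of_subset_of_nonneg (subset_univ _) fun _ _ _ ↦ hε.le
      _ = ε * Fintype.card (m × n) := by rw [sum_const, card_univ, nsmul_eq_mul, mul_comm]
  -- … and vanishes when no support arc enters
  have hlo_zero : ∀ (I₀ : Finset m) (J₀ : Finset n), (∀ i ∈ I₀ᶜ, ∀ j ∈ J₀, A i j = 0) →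
      ∑ p ∈ I₀ᶜ ×ˢ J₀, lo p = 0 := fun I₀ J₀ h ↦
    sum_eq_zero fun p hp ↦ by
      obtain ⟨h1, h2⟩ := mem_product.1 hp
      simp [hlo, h p.1 h1 p.2 h2]
  -- a support arc leaving the cut gives capacity `M`
  have hbig : ∀ (I₀ : Finset m) (J₀ : Finset n), (∃ i ∈ I₀, ∃ j ∉ J₀, A i j ≠ 0) →
      M ≤ ∑ p ∈ I₀ ×ˢ J₀ᶜ, up p := fun I₀ J₀ ⟨i, hi, j, hj, hij⟩ ↦ by
    have hmem : (i, j) ∈ I₀ ×ˢ J₀ᶜ := mem_product.2 ⟨hi, mem_compl.2 hj⟩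
    calc M = up (i, j) := by simp [hup, hij]
      _ ≤ ∑ p ∈ I₀ ×ˢ J₀ᶜ, up p := single_le_sum (fun p _ ↦ hup0 p) hmem
  -- Menon's condition at the complementary cut, with its equality clause turned into positive slack
  have hmenon : ∀ (I₀ : Finset m) (J₀ : Finset n), (∀ i ∈ I₀, ∀ j ∉ J₀, A i j = 0) →
      ∑ i ∈ I₀, r i + ∑ p ∈ I₀ᶜ ×ˢ J₀, lo p ≤ ∑ j ∈ J₀, c j := fun I₀ J₀ hz ↦ by
    have h := hcut I₀ᶜ J₀ᶜ fun i hi j hj ↦ hz i (by simpa using hi) j (by simpa using hj)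
    rw [hrc, hcc] at h
    obtain ⟨hle', hiff⟩ := h
    by_cases hz' : ∀ i ∈ I₀ᶜ, ∀ j ∈ J₀, A i j = 0
    · rw [hlo_zero I₀ J₀ hz', add_zero]; linarith
    · -- strict inequality: positive slack `δ I₀ J₀ > 0`, and the `lo`-mass is below it
      have hne : ¬ (∑ i, r i - ∑ j ∈ J₀, c j = ∑ i, r i - ∑ i ∈ I₀, r i) := fun heq ↦
        hz' fun i hi j hj ↦ hiff.1 heq i hi j (by simpa using hj)
      have hpos : 0 < δ I₀ J₀ := by
        simp only [hδ]
        rcases hle'.lt_or_eq with hlt | heq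
        · linarith
        · exact absurd heq hne
      have h3 := hεδ I₀ J₀ hpos
      simp only [hδ] at h3
      linarith [hloN I₀ J₀]
  have h1 : ∀ (I₀ : Finset m) (J₀ : Finset n),
      ∑ i ∈ I₀, r i + ∑ p ∈ I₀ᶜ ×ˢ J₀, lo p ≤ ∑ p ∈ I₀ ×ˢ J₀ᶜ, up p + ∑ j ∈ J₀, c j := by
    intro I₀ J₀
    by_cases hex : ∃ i ∈ I₀, ∃ j ∉ J₀, A i j ≠ 0
    · calc ∑ i ∈ I₀, r i + ∑ p ∈ I₀ᶜ ×ˢ J₀, lo p ≤ ∑ i, r i + ε * Fintype.card (m × n) :=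
            add_le_add (hrI I₀) (hloN I₀ J₀)
        _ ≤ M := by rw [hM]; linarith
        _ ≤ ∑ p ∈ I₀ ×ˢ J₀ᶜ, up p := hbig I₀ J₀ hex
        _ ≤ ∑ p ∈ I₀ ×ˢ J₀ᶜ, up p + ∑ j ∈ J₀, c j := le_add_of_nonneg_right (sum_nonneg fun j _ ↦ hc j)
    · push Not at hex
      exact (hmenon I₀ J₀ hex).trans (le_add_of_nonneg_left (sum_nonneg fun p _ ↦ hup0 p))
  have h2 : ∀ (I₀ : Finset m) (J₀ : Finset n),
      ∑ p ∈ I₀ᶜ ×ˢ J₀, lo p + ∑ j ∈ J₀ᶜ, c j ≤ ∑ i ∈ I₀ᶜ, r i + ∑ p ∈ I₀ ×ˢ J₀ᶜ, up p := by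
    intro I₀ J₀
    by_cases hex : ∃ i ∈ I₀, ∃ j ∉ J₀, A i j ≠ 0
    · calc ∑ p ∈ I₀ᶜ ×ˢ J₀, lo p + ∑ j ∈ J₀ᶜ, c j ≤ ε * Fintype.card (m × n) + ∑ i, r i :=
            add_le_add (hloN I₀ J₀) (hcJ J₀ᶜ)
        _ ≤ M := by rw [hM]; linarith
        _ ≤ ∑ p ∈ I₀ ×ˢ J₀ᶜ, up p := hbig I₀ J₀ hex
        _ ≤ ∑ i ∈ I₀ᶜ, r i + ∑ p ∈ I₀ ×ˢ J₀ᶜ, up p := le_add_of_nonneg_left (sum_nonneg fun i _ ↦ hr i)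
    · push Not at hex
      have h := hmenon I₀ J₀ hex
      rw [hrc, hcc]
      calc ∑ p ∈ I₀ᶜ ×ˢ J₀, lo p + (∑ i, r i - ∑ j ∈ J₀, c j) ≤ ∑ i, r i - ∑ i ∈ I₀, r i := by linarith
        _ ≤ ∑ i, r i - ∑ i ∈ I₀, r i + ∑ p ∈ I₀ ×ˢ J₀ᶜ, up p :=
            le_add_of_nonneg_right (sum_nonneg fun p _ ↦ hup0 p)
  obtain ⟨B, hB, hBr, hBc⟩ := exists_matrix_of_cuts r c lo up hle h1 h2
  refine ⟨B, fun i j ↦ (hlo0 (i, j)).trans (hB i j).1, fun i j ↦ ⟨fun hij ↦ ?_, fun hij ↦ ?_⟩, hBr, hBc⟩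
  · have h := (hB i j).2
    simp only [hup, hij, if_true] at h
    exact le_antisymm h ((hlo0 (i, j)).trans (hB i j).1)
  · by_contra haij
    have h := (hB i j).1
    simp only [hlo, haij, if_false] at h
    linarith

/-- **Idel Theorem 4.1, (ii) ⇔ (iv)** (for `r, c ≥ 0`): a nonnegative matrix with the pattern of `A`, row sums `r`
and column sums `c` exists iff Menon's cut conditions hold — `Σ_{j∈J} c_j ≤ Σ_{i∈I} r_i` whenever `A_{IᶜJ} = 0`,
with equality iff `A_{IJᶜ} = 0` (necessity: ✔ `ScalingCutConditions`). [cite: Idel2016, §4 Theorem 4.1 ((ii) ⇔ (iv)), p0013] -/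
theorem exists_pattern_margins_iff_menon (A : Matrix m n ℝ) {r : m → ℝ} {c : n → ℝ} (hr : ∀ i, 0 ≤ r i)
    (hc : ∀ j, 0 ≤ c j) :
    (∃ B : Matrix m n ℝ, (∀ i j, 0 ≤ B i j) ∧ (∀ i j, A i j = 0 ↔ B i j = 0) ∧ (∀ i, ∑ j, B i j = r i) ∧
      ∀ j, ∑ i, B i j = c j) ↔
    ∀ (I : Finset m) (J : Finset n), (∀ i ∉ I, ∀ j ∈ J, A i j = 0) →
      ∑ j ∈ J, c j ≤ ∑ i ∈ I, r i ∧ (∑ j ∈ J, c j = ∑ i ∈ I, r i ↔ ∀ i ∈ I, ∀ j ∉ J, A i j = 0) := by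
  constructor
  · rintro ⟨B, hB, hpat, hBr, hBc⟩ I J hzero
    exact ⟨ScalingCutConditions.sum_col_le_sum_row_of_zero_block hB hpat hBr hBc hzero,
      ScalingCutConditions.sum_col_eq_sum_row_iff hB hpat hBr hBc hzero⟩
  · exact exists_pattern_margins_of_menon A hr hc

/-- **Menon's theorem ∕ Idel Theorem 4.1, (i) ⇔ (iv)** (for `A ≥ 0`, `r, c ≥ 0`): there are positive diagonal
scalings `D(y) A D(x)` with row sums `r` and column sums `c` iff Menon's cut conditions hold. ((i) ⇔ (ii) is the
tree's Idel Theorem 3.1 `MatrixScalingPattern.exists_scaling_iff_pattern`.)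
[cite: Idel2016, §4 Theorem 4.1 ((i) ⇔ (iv)), p0013] -/
theorem exists_scaling_iff_menon {A : Matrix m n ℝ} (hA : ∀ i j, 0 ≤ A i j) {r : m → ℝ} {c : n → ℝ}
    (hr : ∀ i, 0 ≤ r i) (hc : ∀ j, 0 ≤ c j) :
    (∃ x : n → ℝ, ∃ y : m → ℝ, (∀ j, 0 < x j) ∧ (∀ i, 0 < y i) ∧
      (∀ i, ∑ j, y i * A i j * x j = r i) ∧ (∀ j, ∑ i, y i * A i j * x j = c j)) ↔
    ∀ (I : Finset m) (J : Finset n), (∀ i ∉ I, ∀ j ∈ J, A i j = 0) →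
      ∑ j ∈ J, c j ≤ ∑ i ∈ I, r i ∧ (∑ j ∈ J, c j = ∑ i ∈ I, r i ↔ ∀ i ∈ I, ∀ j ∉ J, A i j = 0) := by
  rw [MatrixScalingPattern.exists_scaling_iff_pattern hA]
  exact exists_pattern_margins_iff_menon A hr hc

end Literature.LinearAlgebra.Matrix.PatternMarginsCutConditions
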